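import Mathlib.Analysis.SpecialFunctions.Integrability.Basic
import Literature.Analysis.FluidPDE.NSLerayHopfABCSimilarity
import Literature.Analysis.FluidPDE.NSLerayHopfABCScaling
import Literature.Analysis.FluidPDE.LerayHopfForcedOpenStripContinuity
import HarnessLib

/-!
# Albritton–Brué–Colombo 2022: the `L^p` scalings (1.13)–(1.14) of the ansatz, the Leray–Hopf
  property of profile solutions, and the assembly Thm. 1.3-type data ⟹ Thm. 1.2

Analysis/FluidPDE proofs-layer file (theorems only, no definitions, no named facts) on the proof
line of the named fact `Literature.Analysis.FluidPDE.albritton_brue_colombo` (Albritton–Brué–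
Colombo, Ann. of Math. 196 (2022) = arXiv:2112.03116 [ABC], Thm. 1.2; `NSLerayHopf.lean`; its
printed unit-viscosity form `albritton_brue_colombo_unit` and the scaling reduction
`albritton_brue_colombo_of_unit` are in `NSLerayHopfABCScaling.lean`). It closes the formal
rendering of everything in [ABC] DOWNSTREAM of Thm. 1.3 (a)–(b):

* **the `L^p` scalings of the ansatz** `u = physVelocity U`, `p = physPressure P`,
  `f = physForce F` (`NSLerayHopfABCSimilarity.lean`) on `ℝ³` — (1.13)–(1.14) in `lintegral`
  form: `∫|u(t)|² = √t ∫|U|²`, `∫|∇u(t)|² = (√t)⁻¹∫|∇U|²`, `∫|u(t)|³ = ∫|U|³`,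
  `∫|p(t)||u(t)| = ∫|P||U|`, `∫|f(t)||u(t)| = (√t)⁻¹∫|F||U|`, `∫|f(t)|² = (√t)⁻³∫|F|²`
  (`lintegral_enorm_sq_physVelocity`, …, `lintegral_enorm_sq_physForce`), whence
  `‖u(t)‖₂ ≤ (√t M)^{1/2} → 0` (`eLpNorm_physVelocity_le`, `tendsto_eLpNorm_physVelocity_zero`),
  `‖f(t)‖₂ ≤ t^{-3/4}M^{1/2}` and `f ∈ L¹(0,T;L²)` (`eLpNorm_physForce_le`, `memLqLp_physForce`,
  (1.14)), `f ∈ L¹` on finite cylinders (`integrableOn_physForce_cylinder`);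
* **`IsSimilarityNSSolutionOn.isLerayHopfOn_phys`** — a classical solution `(U, P)` of the
  similarity system (1.9) on `τ < τ₁` with `sup_τ ‖U‖₂², ‖∇U‖₂², ‖U‖₃³, ‖P‖₂², ‖F‖₂² < ∞` gives
  a Leray–Hopf weak solution `physVelocity U` (accepted strict sense, energy equalities) with
  viscosity `1`, force `physForce F` and datum `0` on `[0, T']`, `T' < e^{τ₁}` — the step "`ū`,
  `u` are Leray–Hopf solutions with `u₀ ≡ 0`" of Thm. 1.3, via the transport
  `isClassicalNSSolutionOn_phys_Iio` and the criterion `isLerayHopfOn_of_classical_Ioo_forced_R3`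
  (`LerayHopfForcedOpenStripContinuity.lean`);
* **`albritton_brue_colombo_unit_of_similarityProfiles`**,
  **`albritton_brue_colombo_of_similarityProfiles`** — two such solutions for ONE force profile,
  differing at some similarity time on a set of positive measure (`not_ae_eq_physVelocity_exp`:
  dilations preserve "not a.e. equal"), give the printed unit-viscosity statement (Thm. 1.2) in
  its **faithful** rendering, the named fact `albritton_brue_colombo_unit`
  (`NSLerayHopfABCScaling.lean`, as restated 2026-08-15) — the force `f = physForce F` is *jointly
  measurable* on `(0, T) × ℝ³` (`AEStronglyMeasurable (uncurry f) (volume.restrict (Ioo 0 T ×ˢ univ))`,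
  from the continuity of the force of a classical solution) **and** in `L¹(0, T; L²)` — hence,
  forgetting the measurability clause, `albritton_brue_colombo` for every viscosity
  (`albritton_brue_colombo_of_unit`). The measurability clause is what separates Def. 1.1's
  Bochner class `f ∈ L¹_t L²_x` from the tree's slice-wise `MemLqLp`, whose unguarded use makes
  the rendering `albritton_brue_colombo` (and the retired first rendering of
  `albritton_brue_colombo_unit`) provable by a degenerate example
  (`ABCVacuity.rendering_is_vacuous`, `NSLerayHopfABCVacuity.lean`); the conclusion proved here is
  the non-vacuous one.

## What remains for `albritton_brue_colombo_holds`

Exactly an inhabitant of the hypotheses of `albritton_brue_colombo_of_similarityProfiles`, i.e.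
[ABC] Thm. 1.3: a smooth compactly supported divergence-free `Ū` whose linearisation `L_ss`
(1.10) has an unstable eigenvalue (part (a): Vishik's unstable vortex, §2; vortex-ring lift,
Prop. 2.6; Euler ⟹ Navier–Stokes spectral perturbation, Thm. 3.1 / Cor. 3.2) and the trajectory
`U = Ū + U^{lin} + U^{per}` on its unstable manifold (part (b) = Thm. 4.1: semigroup and
spectral bounds for `L_ss`, Lemma 4.4, the fixed point Prop. 4.5/4.7, the bootstrap §4.2.7),
together with the pressure of `U` (Riesz transforms of the quadratic terms) and the uniform
`H^k` bounds. None of this (unbounded non-self-adjoint spectral theory, parabolic semigroups on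
`L²_σ(ℝ³)`) is in Mathlib or the tree; it is the analytic core of the paper and is NOT touched
here. `U₁ = Ū` is available already (`IsSimilarityNSSolutionOn.steady`, (1.11)).

## Design notes

* Bounds are phrased as `lintegral` bounds by one constant `M : ℝ≥0∞`, `M ≠ ⊤` (take the max);
  `sup_{τ<τ₁}` is what Thm. 1.3 (b) gives (`‖U^{per}‖_{H^k} ≲ e^{2τa}`, `‖U^{lin}‖_{H^k} ≍ e^{τa}`,
  `Ū ∈ C_c^∞`; `L³` by Sobolev; the pressure is quadratic in `U` through Riesz transforms).
* The force profile's measurability is derived, not assumed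
  (`IsSimilarityNSSolutionOn.isSmoothSpaceTimeOn_force`: (1.9) determines `F`).
* `ℝ³` throughout this file (the exponents `t^{1/4}`, `t^{-3/4}` are dimensional); the
  dictionary file is dimension-free.

## Tree / Mathlib search

Tree: `lintegral_comp_space_affine` (`SpaceTimeRescaling`), `frobeniusNormSq_smul`,
`eEnergy_eq_eLpNorm_sq`, `MemLqLp`/`eLqLpNorm` (`LerayHopf`), `albritton_brue_colombo_unit` /
`albritton_brue_colombo_of_unit` (`NSLerayHopfABCScaling`), `isLerayHopfOn_of_classical_Ioo_forced_R3`,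
`IsClassicalNSSolutionOn.continuousOn_force`/`continuous_force_slice`, `IsSmoothSpaceTimeOn.*`
algebra (`ClassicalSolutionCalculus`). Mathlib: `ENNReal.lintegral_mul_le_Lp_mul_Lq`,
`intervalIntegral.integrableOn_Ioo_rpow_iff`, `Measure.map_addHaar_smul`,
`measurableEmbedding_const_smul₀`, `MeasurableEmbedding.ae_map_iff`, `lintegral_prod_le`,
`Measure.prod_restrict`, `ENNReal.continuous_rpow_const`, `ContinuousOn.aestronglyMeasurable`.

## References

* D. Albritton, E. Brué, M. Colombo, *Non-uniqueness of Leray solutions of the forced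
  Navier–Stokes equations*, Ann. of Math. 196 (2022) 415–455 = arXiv:2112.03116, Def. 1.1,
  Thm. 1.2, §1.1 (1.7)–(1.11), Thm. 1.3 with (1.13)–(1.14), §§2–4. [AlbrittonBrueColombo2022]
* J. Leray, Acta Math. 63 (1934), §17 (3.4), §32. [Leray1934]
-/

noncomputable section

open MeasureTheory TopologicalSpace Set Function Filter Topology InnerProductSpace Module
open scoped RealInnerProductSpace NNReal ENNReal Laplacian ContDiff

namespace Literature.Analysis.FluidPDE

/-! ### Two measure-theoretic helpers -/

section Helpers

variable {α : Type*} [MeasurableSpace α] {μ : Measure α}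

/-- **Cauchy–Schwarz for `lintegral`s of vector fields**: `∫⁻ ‖F‖ₑ‖G‖ₑ ≤ (∫⁻‖F‖ₑ²)^{1/2}
(∫⁻‖G‖ₑ²)^{1/2}` (Hölder with exponents `(2, 2)`, Mathlib's `ENNReal.lintegral_mul_le_Lp_mul_Lq`).
[folklore] -/
theorem lintegral_enorm_mul_enorm_le_sqrt {V W : Type*} [NormedAddCommGroup V]
    [NormedAddCommGroup W] {F : α → V} {G : α → W} (hF : AEStronglyMeasurable F μ)
    (hG : AEStronglyMeasurable G μ) :
    ∫⁻ x, ‖F x‖ₑ * ‖G x‖ₑ ∂μ ≤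
      (∫⁻ x, ‖F x‖ₑ ^ 2 ∂μ) ^ (1 / 2 : ℝ) * (∫⁻ x, ‖G x‖ₑ ^ 2 ∂μ) ^ (1 / 2 : ℝ) := by
  have h := ENNReal.lintegral_mul_le_Lp_mul_Lq μ Real.HolderConjugate.two_two hF.enorm hG.enorm
  simp only [Pi.mul_apply] at h
  refine h.trans (le_of_eq ?_)
  congr 2
  · exact lintegral_congr fun x => by rw [← ENNReal.rpow_two]
  · exact lintegral_congr fun x => by rw [← ENNReal.rpow_two]

/-- `∫⁻_{(0,T)} t^r dt < ∞` for `r > −1` (as an `ofReal`-valued integrand; Mathlib's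
`intervalIntegral.integrableOn_Ioo_rpow_iff`). [folklore] -/
theorem lintegral_ofReal_rpow_Ioo_lt_top {r T : ℝ} (hr : -1 < r) (hT : 0 < T) :
    ∫⁻ t in Ioo 0 T, ENNReal.ofReal (t ^ r) < ⊤ := by
  have hint : IntegrableOn (fun t : ℝ => t ^ r) (Ioo 0 T) volume :=
    (intervalIntegral.integrableOn_Ioo_rpow_iff hT).2 hr
  calc ∫⁻ t in Ioo 0 T, ENNReal.ofReal (t ^ r)
      ≤ ∫⁻ t in Ioo 0 T, ‖t ^ r‖ₑ := lintegral_mono fun t => Real.ofReal_le_enorm _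
    _ < ⊤ := hint.2

end Helpers

/-! ### The `L^p` scalings (1.13)–(1.14) of the ansatz on `ℝ³` -/

namespace AlbrittonBrueColombo2022

section Scalings

variable {t : ℝ}

/-- The substitution `x = √t ξ` in `ℝ³`: `∫⁻ G(x/√t) dx = (√t)³ ∫⁻ G(ξ) dξ` for `t > 0`. [folklore] -/
theorem lintegral_comp_sqrt_inv_smul (ht : 0 < t) (G : EuclideanSpace ℝ (Fin 3) → ℝ≥0∞) :
    ∫⁻ x, G ((Real.sqrt t)⁻¹ • x) = ENNReal.ofReal ((Real.sqrt t) ^ 3) * ∫⁻ ξ, G ξ := by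
  have h := lintegral_comp_space_affine (sqrt_inv_pos ht) (0 : EuclideanSpace ℝ (Fin 3)) G
  simp only [zero_add, finrank_euclideanSpace_fin, inv_pow, inv_inv] at h
  exact h

/-- `c⁻¹`-powers bookkeeping: `(√t)⁻¹ ^ 2 * (√t) ^ 3 = √t` for `t > 0`. [folklore] -/
theorem sqrt_inv_sq_mul_sqrt_cube (ht : 0 < t) :
    (Real.sqrt t)⁻¹ ^ 2 * (Real.sqrt t) ^ 3 = Real.sqrt t := by
  have hne : Real.sqrt t ≠ 0 := (Real.sqrt_pos.2 ht).ne'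
  field_simp

/-- **(1.13), `p = 2`, `k = 0`: `‖u(t)‖₂² = √t ‖U(log t)‖₂²`** (`∫|t^{-1/2}U(x/√t)|² dx =
t^{-1} t^{3/2} ∫|U|²`). [cite: AlbrittonBrueColombo2022, (1.13)] -/
theorem lintegral_enorm_sq_physVelocity (ht : 0 < t)
    (U : ℝ → EuclideanSpace ℝ (Fin 3) → EuclideanSpace ℝ (Fin 3)) :
    ∫⁻ x, ‖physVelocity U t x‖ₑ ^ 2 =
      ENNReal.ofReal (Real.sqrt t) * ∫⁻ ξ, ‖U (Real.log t) ξ‖ₑ ^ 2 := by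
  have hc : 0 < (Real.sqrt t)⁻¹ := sqrt_inv_pos ht
  have h1 : ∀ x, ‖physVelocity U t x‖ₑ ^ 2 =
      ENNReal.ofReal ((Real.sqrt t)⁻¹ ^ 2) * ‖U (Real.log t) ((Real.sqrt t)⁻¹ • x)‖ₑ ^ 2 := by
    intro x
    rw [physVelocity_apply, enorm_smul, mul_pow, Real.enorm_eq_ofReal hc.le, ENNReal.ofReal_pow hc.le]
  simp_rw [h1]
  rw [lintegral_const_mul' _ _ ENNReal.ofReal_ne_top,
    lintegral_comp_sqrt_inv_smul ht (fun ξ => ‖U (Real.log t) ξ‖ₑ ^ 2), ← mul_assoc,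
    ← ENNReal.ofReal_mul (by positivity), sqrt_inv_sq_mul_sqrt_cube ht]

/-- **(1.13), `p = 2`, `k = 1`: `‖∇u(t)‖₂² = (√t)⁻¹ ‖∇U(log t)‖₂²`** (Frobenius norms of the
derivatives; `Du(t)(x) = t⁻¹ DU(x/√t)`). [cite: AlbrittonBrueColombo2022, (1.13)] -/
theorem lintegral_frobeniusNormSq_fderiv_physVelocity (ht : 0 < t)
    (U : ℝ → EuclideanSpace ℝ (Fin 3) → EuclideanSpace ℝ (Fin 3)) :
    ∫⁻ x, ENNReal.ofReal (frobeniusNormSq (fderiv ℝ (physVelocity U t) x)) =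
      ENNReal.ofReal ((Real.sqrt t)⁻¹) *
        ∫⁻ ξ, ENNReal.ofReal (frobeniusNormSq (fderiv ℝ (U (Real.log t)) ξ)) := by
  have hc : 0 < (Real.sqrt t)⁻¹ := sqrt_inv_pos ht
  have h1 : ∀ x, ENNReal.ofReal (frobeniusNormSq (fderiv ℝ (physVelocity U t) x)) =
      ENNReal.ofReal (((Real.sqrt t)⁻¹ ^ 2) ^ 2) *
        ENNReal.ofReal (frobeniusNormSq (fderiv ℝ (U (Real.log t)) ((Real.sqrt t)⁻¹ • x))) := by
    intro x
    rw [fderiv_physVelocity, frobeniusNormSq_smul, ENNReal.ofReal_mul (by positivity)]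
  simp_rw [h1]
  rw [lintegral_const_mul' _ _ ENNReal.ofReal_ne_top,
    lintegral_comp_sqrt_inv_smul ht
      (fun ξ => ENNReal.ofReal (frobeniusNormSq (fderiv ℝ (U (Real.log t)) ξ))),
    ← mul_assoc, ← ENNReal.ofReal_mul (by positivity)]
  congr 2
  have hne : Real.sqrt t ≠ 0 := (Real.sqrt_pos.2 ht).ne'
  have hsq : Real.sqrt t ^ 2 = t := Real.sq_sqrt ht.le
  field_simp

/-- **(1.13), `p = 3`, `k = 0`: `‖u(t)‖₃ = ‖U(log t)‖₃`** (the `L³` norm is scale invariant).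
[cite: AlbrittonBrueColombo2022, (1.13)] -/
theorem lintegral_enorm_cube_physVelocity (ht : 0 < t)
    (U : ℝ → EuclideanSpace ℝ (Fin 3) → EuclideanSpace ℝ (Fin 3)) :
    ∫⁻ x, ‖physVelocity U t x‖ₑ ^ (3 : ℕ) = ∫⁻ ξ, ‖U (Real.log t) ξ‖ₑ ^ (3 : ℕ) := by
  have hc : 0 < (Real.sqrt t)⁻¹ := sqrt_inv_pos ht
  have h1 : ∀ x, ‖physVelocity U t x‖ₑ ^ (3 : ℕ) =
      ENNReal.ofReal ((Real.sqrt t)⁻¹ ^ 3) * ‖U (Real.log t) ((Real.sqrt t)⁻¹ • x)‖ₑ ^ (3 : ℕ) := by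
    intro x
    rw [physVelocity_apply, enorm_smul, mul_pow, Real.enorm_eq_ofReal hc.le, ENNReal.ofReal_pow hc.le]
  simp_rw [h1]
  rw [lintegral_const_mul' _ _ ENNReal.ofReal_ne_top,
    lintegral_comp_sqrt_inv_smul ht (fun ξ => ‖U (Real.log t) ξ‖ₑ ^ (3 : ℕ)), ← mul_assoc,
    ← ENNReal.ofReal_mul (by positivity)]
  have hne : Real.sqrt t ≠ 0 := (Real.sqrt_pos.2 ht).ne'
  rw [show (Real.sqrt t)⁻¹ ^ 3 * Real.sqrt t ^ 3 = 1 by field_simp, ENNReal.ofReal_one, one_mul]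

/-- **The pressure–velocity pairing is scale invariant**: `∫|p(t)||u(t)| = ∫|P(log t)||U(log t)|`
(`t⁻¹ · t^{-1/2} · t^{3/2} = 1`). [cite: AlbrittonBrueColombo2022, (1.13)] -/
theorem lintegral_enorm_physPressure_mul_physVelocity (ht : 0 < t)
    (P : ℝ → EuclideanSpace ℝ (Fin 3) → ℝ)
    (U : ℝ → EuclideanSpace ℝ (Fin 3) → EuclideanSpace ℝ (Fin 3)) :
    ∫⁻ x, ‖physPressure P t x‖ₑ * ‖physVelocity U t x‖ₑ =
      ∫⁻ ξ, ‖P (Real.log t) ξ‖ₑ * ‖U (Real.log t) ξ‖ₑ := by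
  have hc : 0 < (Real.sqrt t)⁻¹ := sqrt_inv_pos ht
  have h1 : ∀ x, ‖physPressure P t x‖ₑ * ‖physVelocity U t x‖ₑ =
      ENNReal.ofReal (t⁻¹ * (Real.sqrt t)⁻¹) *
        (‖P (Real.log t) ((Real.sqrt t)⁻¹ • x)‖ₑ * ‖U (Real.log t) ((Real.sqrt t)⁻¹ • x)‖ₑ) := by
    intro x
    rw [physPressure_apply, physVelocity_apply, enorm_mul, enorm_smul,
      Real.enorm_eq_ofReal hc.le, Real.enorm_eq_ofReal (inv_nonneg.2 ht.le),
      ENNReal.ofReal_mul (inv_nonneg.2 ht.le)]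
    ring
  simp_rw [h1]
  rw [lintegral_const_mul' _ _ ENNReal.ofReal_ne_top,
    lintegral_comp_sqrt_inv_smul ht
      (fun ξ => ‖P (Real.log t) ξ‖ₑ * ‖U (Real.log t) ξ‖ₑ), ← mul_assoc,
    ← ENNReal.ofReal_mul (by positivity)]
  have hne : Real.sqrt t ≠ 0 := (Real.sqrt_pos.2 ht).ne'
  have hsq : Real.sqrt t ^ 2 = t := Real.sq_sqrt ht.le
  rw [show t⁻¹ * (Real.sqrt t)⁻¹ * Real.sqrt t ^ 3 = 1 by
    rw [show Real.sqrt t ^ 3 = t * Real.sqrt t by rw [pow_succ, hsq]]; field_simp,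
    ENNReal.ofReal_one, one_mul]

/-- **The work of the force**: `∫|f(t)||u(t)| = (√t)⁻¹ ∫|F(log t)||U(log t)|`
(`t^{-3/2} · t^{-1/2} · t^{3/2} = t^{-1/2}`). [cite: AlbrittonBrueColombo2022, (1.13)–(1.14)] -/
theorem lintegral_enorm_physForce_mul_physVelocity (ht : 0 < t)
    (F U : ℝ → EuclideanSpace ℝ (Fin 3) → EuclideanSpace ℝ (Fin 3)) :
    ∫⁻ x, ‖physForce F t x‖ₑ * ‖physVelocity U t x‖ₑ =
      ENNReal.ofReal ((Real.sqrt t)⁻¹) * ∫⁻ ξ, ‖F (Real.log t) ξ‖ₑ * ‖U (Real.log t) ξ‖ₑ := by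
  have hc : 0 < (Real.sqrt t)⁻¹ := sqrt_inv_pos ht
  have h1 : ∀ x, ‖physForce F t x‖ₑ * ‖physVelocity U t x‖ₑ =
      ENNReal.ofReal ((Real.sqrt t)⁻¹ ^ 3 * (Real.sqrt t)⁻¹) *
        (‖F (Real.log t) ((Real.sqrt t)⁻¹ • x)‖ₑ * ‖U (Real.log t) ((Real.sqrt t)⁻¹ • x)‖ₑ) := by
    intro x
    rw [physForce_apply, physVelocity_apply, enorm_smul, enorm_smul,
      Real.enorm_eq_ofReal hc.le, Real.enorm_eq_ofReal (by positivity),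
      ENNReal.ofReal_mul (by positivity)]
    ring
  simp_rw [h1]
  rw [lintegral_const_mul' _ _ ENNReal.ofReal_ne_top,
    lintegral_comp_sqrt_inv_smul ht
      (fun ξ => ‖F (Real.log t) ξ‖ₑ * ‖U (Real.log t) ξ‖ₑ), ← mul_assoc,
    ← ENNReal.ofReal_mul (by positivity)]
  have hne : Real.sqrt t ≠ 0 := (Real.sqrt_pos.2 ht).ne'
  rw [show (Real.sqrt t)⁻¹ ^ 3 * (Real.sqrt t)⁻¹ * Real.sqrt t ^ 3 = (Real.sqrt t)⁻¹ by field_simp]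

/-- **(1.14): `‖f(t)‖₂² = (√t)⁻³ ‖F(log t)‖₂²`**, i.e. `‖f(t)‖_{L²} = t^{-3/4}‖F‖_{L²}`
(`t^{-3} · t^{3/2}`), so that `f ∈ L¹(0, T; L²)`. [cite: AlbrittonBrueColombo2022, (1.14)] -/
theorem lintegral_enorm_sq_physForce (ht : 0 < t)
    (F : ℝ → EuclideanSpace ℝ (Fin 3) → EuclideanSpace ℝ (Fin 3)) :
    ∫⁻ x, ‖physForce F t x‖ₑ ^ 2 =
      ENNReal.ofReal ((Real.sqrt t)⁻¹ ^ 3) * ∫⁻ ξ, ‖F (Real.log t) ξ‖ₑ ^ 2 := by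
  have hc : 0 < (Real.sqrt t)⁻¹ := sqrt_inv_pos ht
  have h1 : ∀ x, ‖physForce F t x‖ₑ ^ 2 =
      ENNReal.ofReal (((Real.sqrt t)⁻¹ ^ 3) ^ 2) * ‖F (Real.log t) ((Real.sqrt t)⁻¹ • x)‖ₑ ^ 2 := by
    intro x
    rw [physForce_apply, enorm_smul, mul_pow, Real.enorm_eq_ofReal (by positivity),
      ← ENNReal.ofReal_pow (pow_nonneg hc.le 3)]
  simp_rw [h1]
  rw [lintegral_const_mul' _ _ ENNReal.ofReal_ne_top,
    lintegral_comp_sqrt_inv_smul ht (fun ξ => ‖F (Real.log t) ξ‖ₑ ^ 2), ← mul_assoc,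
    ← ENNReal.ofReal_mul (by positivity)]
  have hne : Real.sqrt t ≠ 0 := (Real.sqrt_pos.2 ht).ne'
  rw [show ((Real.sqrt t)⁻¹ ^ 3) ^ 2 * Real.sqrt t ^ 3 = (Real.sqrt t)⁻¹ ^ 3 by field_simp]

/-- The junk value at `t = 0` is the zero field: `physVelocity U 0 = 0` (`√0 = 0`). [folklore] -/
theorem physVelocity_zero (U : ℝ → EuclideanSpace ℝ (Fin 3) → EuclideanSpace ℝ (Fin 3)) :
    physVelocity U 0 = 0 := by
  funext x
  simp [physVelocity]

end Scalings

/-! ### From uniform profile bounds to the hypotheses of the Leray–Hopf criterion -/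

section Bounds

/-- `(√t)⁻¹ = t^{-1/2}` for `t > 0`. [folklore] -/
theorem sqrt_inv_eq_rpow {t : ℝ} (ht : 0 < t) : (Real.sqrt t)⁻¹ = t ^ (-(1 / 2 : ℝ)) := by
  rw [Real.sqrt_eq_rpow, Real.rpow_neg ht.le]

/-- `∫⁻_{(0,T)} (√t)⁻¹ dt < ∞`. [folklore] -/
theorem lintegral_ofReal_sqrt_inv_Ioo_lt_top {T : ℝ} (hT : 0 < T) :
    ∫⁻ t in Ioo 0 T, ENNReal.ofReal ((Real.sqrt t)⁻¹) < ⊤ := by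
  have h := lintegral_ofReal_rpow_Ioo_lt_top (r := -(1 / 2 : ℝ)) (by norm_num) hT
  refine lt_of_le_of_lt (le_of_eq ?_) h
  refine setLIntegral_congr_fun measurableSet_Ioo fun t ht => ?_
  rw [sqrt_inv_eq_rpow ht.1]

/-- `((√t)⁻¹)³ = (t^{-3/4})²` for `t > 0` (so that `‖f(t)‖₂ = t^{-3/4}‖F‖₂`). [folklore] -/
theorem sqrt_inv_cube_eq_rpow_sq {t : ℝ} (ht : 0 < t) :
    (Real.sqrt t)⁻¹ ^ 3 = (t ^ (-(3 / 4 : ℝ))) ^ 2 := by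
  rw [sqrt_inv_eq_rpow ht, ← Real.rpow_natCast, ← Real.rpow_mul ht.le, ← Real.rpow_natCast,
    ← Real.rpow_mul ht.le]
  norm_num

/-- The `L²` norm as a power of the extended energy: `‖v‖₂ = (∫⁻‖v‖ₑ²)^{1/2}`. [folklore] -/
theorem eLpNorm_two_eq_lintegral_rpow_half {X : Type*} [MeasurableSpace X] {μ : Measure X}
    {V : Type*} [NormedAddCommGroup V] (v : X → V) :
    eLpNorm v 2 μ = (∫⁻ x, ‖v x‖ₑ ^ 2 ∂μ) ^ (1 / 2 : ℝ) := by
  rw [eLpNorm_eq_lintegral_rpow_enorm_toReal two_ne_zero ENNReal.ofNat_ne_top]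
  simp only [ENNReal.toReal_ofNat, one_div]
  congr 1
  exact lintegral_congr fun x => by rw [← ENNReal.rpow_two]

variable {U F : ℝ → EuclideanSpace ℝ (Fin 3) → EuclideanSpace ℝ (Fin 3)}
  {P : ℝ → EuclideanSpace ℝ (Fin 3) → ℝ} {M : ℝ≥0∞} {t : ℝ}

/-- **`‖u(t)‖₂ ≤ (√t M)^{1/2}`** when `‖U(log t)‖₂² ≤ M`. [cite: AlbrittonBrueColombo2022, (1.13)] -/
theorem eLpNorm_physVelocity_le (ht : 0 < t) (hU : ∫⁻ ξ, ‖U (Real.log t) ξ‖ₑ ^ 2 ≤ M) :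
    eLpNorm (physVelocity U t) 2 volume ≤ (ENNReal.ofReal (Real.sqrt t) * M) ^ (1 / 2 : ℝ) := by
  rw [eLpNorm_two_eq_lintegral_rpow_half, lintegral_enorm_sq_physVelocity ht]
  gcongr

/-- **`‖f(t)‖₂ ≤ t^{-3/4} M^{1/2}`** when `‖F(log t)‖₂² ≤ M` ((1.14)). [cite: AlbrittonBrueColombo2022, (1.14)] -/
theorem eLpNorm_physForce_le (ht : 0 < t) (hF : ∫⁻ ξ, ‖F (Real.log t) ξ‖ₑ ^ 2 ≤ M) :
    eLpNorm (physForce F t) 2 volume ≤ ENNReal.ofReal (t ^ (-(3 / 4 : ℝ))) * M ^ (1 / 2 : ℝ) := by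
  rw [eLpNorm_two_eq_lintegral_rpow_half, lintegral_enorm_sq_physForce ht,
    sqrt_inv_cube_eq_rpow_sq ht]
  calc (ENNReal.ofReal ((t ^ (-(3 / 4 : ℝ))) ^ 2) * ∫⁻ ξ, ‖F (Real.log t) ξ‖ₑ ^ 2) ^ (1 / 2 : ℝ)
      ≤ (ENNReal.ofReal ((t ^ (-(3 / 4 : ℝ))) ^ 2) * M) ^ (1 / 2 : ℝ) := by gcongr
    _ = ENNReal.ofReal (t ^ (-(3 / 4 : ℝ))) * M ^ (1 / 2 : ℝ) := by
        rw [ENNReal.mul_rpow_of_nonneg _ _ (by norm_num : (0 : ℝ) ≤ 1 / 2),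
          ENNReal.ofReal_pow (by positivity), ← ENNReal.rpow_natCast, ← ENNReal.rpow_mul]
        norm_num

/-- **`∫|p(t)||u(t)| ≤ M`** when `‖P(log t)‖₂², ‖U(log t)‖₂² ≤ M` (scale invariance and
Cauchy–Schwarz). [cite: AlbrittonBrueColombo2022, (1.13)] -/
theorem lintegral_enorm_physPressure_mul_physVelocity_le (ht : 0 < t)
    (hPm : AEStronglyMeasurable (P (Real.log t)) volume)
    (hUm : AEStronglyMeasurable (U (Real.log t)) volume)
    (hP : ∫⁻ ξ, ‖P (Real.log t) ξ‖ₑ ^ 2 ≤ M) (hU : ∫⁻ ξ, ‖U (Real.log t) ξ‖ₑ ^ 2 ≤ M) :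
    ∫⁻ x, ‖physPressure P t x‖ₑ * ‖physVelocity U t x‖ₑ ≤ M := by
  rw [lintegral_enorm_physPressure_mul_physVelocity ht]
  calc ∫⁻ ξ, ‖P (Real.log t) ξ‖ₑ * ‖U (Real.log t) ξ‖ₑ
      ≤ (∫⁻ ξ, ‖P (Real.log t) ξ‖ₑ ^ 2) ^ (1 / 2 : ℝ) *
          (∫⁻ ξ, ‖U (Real.log t) ξ‖ₑ ^ 2) ^ (1 / 2 : ℝ) :=
        lintegral_enorm_mul_enorm_le_sqrt hPm hUm
    _ ≤ M ^ (1 / 2 : ℝ) * M ^ (1 / 2 : ℝ) := by gcongr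
    _ = M := by
        rw [← ENNReal.rpow_add_of_nonneg _ _ (by norm_num) (by norm_num)]
        norm_num

/-- **`∫|f(t)||u(t)| ≤ (√t)⁻¹ M`** when `‖F(log t)‖₂², ‖U(log t)‖₂² ≤ M`. [cite: AlbrittonBrueColombo2022, (1.13)–(1.14)] -/
theorem lintegral_enorm_physForce_mul_physVelocity_le (ht : 0 < t)
    (hFm : AEStronglyMeasurable (F (Real.log t)) volume)
    (hUm : AEStronglyMeasurable (U (Real.log t)) volume)
    (hF : ∫⁻ ξ, ‖F (Real.log t) ξ‖ₑ ^ 2 ≤ M) (hU : ∫⁻ ξ, ‖U (Real.log t) ξ‖ₑ ^ 2 ≤ M) :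
    ∫⁻ x, ‖physForce F t x‖ₑ * ‖physVelocity U t x‖ₑ ≤ ENNReal.ofReal ((Real.sqrt t)⁻¹) * M := by
  rw [lintegral_enorm_physForce_mul_physVelocity ht]
  gcongr
  calc ∫⁻ ξ, ‖F (Real.log t) ξ‖ₑ * ‖U (Real.log t) ξ‖ₑ
      ≤ (∫⁻ ξ, ‖F (Real.log t) ξ‖ₑ ^ 2) ^ (1 / 2 : ℝ) *
          (∫⁻ ξ, ‖U (Real.log t) ξ‖ₑ ^ 2) ^ (1 / 2 : ℝ) :=
        lintegral_enorm_mul_enorm_le_sqrt hFm hUm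
    _ ≤ M ^ (1 / 2 : ℝ) * M ^ (1 / 2 : ℝ) := by gcongr
    _ = M := by
        rw [← ENNReal.rpow_add_of_nonneg _ _ (by norm_num) (by norm_num)]
        norm_num

/-- `∫_K |g| ≤ |K|^{1/2} ‖g‖_{L²}` (Cauchy–Schwarz on a set). [folklore] -/
theorem setLIntegral_enorm_le_measure_rpow_mul_eLpNorm {V : Type*} [NormedAddCommGroup V]
    {g : EuclideanSpace ℝ (Fin 3) → V} (hg : AEStronglyMeasurable g volume)
    (K : Set (EuclideanSpace ℝ (Fin 3))) :
    ∫⁻ x in K, ‖g x‖ₑ ≤ volume K ^ (1 / 2 : ℝ) * eLpNorm g 2 volume := by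
  have h := lintegral_enorm_mul_enorm_le_sqrt (μ := volume.restrict K) hg.restrict
    (aestronglyMeasurable_const (b := (1 : ℝ)))
  simp only [enorm_one, mul_one, one_pow, lintegral_const, Measure.restrict_apply_univ, one_mul] at h
  calc ∫⁻ x in K, ‖g x‖ₑ ≤ (∫⁻ x in K, ‖g x‖ₑ ^ 2) ^ (1 / 2 : ℝ) * volume K ^ (1 / 2 : ℝ) := h
    _ ≤ (∫⁻ x, ‖g x‖ₑ ^ 2) ^ (1 / 2 : ℝ) * volume K ^ (1 / 2 : ℝ) := by
        gcongr
        exact Measure.restrict_le_self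
    _ = volume K ^ (1 / 2 : ℝ) * eLpNorm g 2 volume := by
        rw [eLpNorm_two_eq_lintegral_rpow_half, mul_comm]

/-- **`f ∈ L¹` on the finite cylinders**: `∫_{(0,T)×K} |f| ≤ |K|^{1/2} M^{1/2} ∫₀ᵀ t^{-3/4} dt < ∞`
for a force ansatz jointly continuous on the open slab with `‖F(log t)‖₂² ≤ M`. [cite: AlbrittonBrueColombo2022, (1.14)] -/
theorem integrableOn_physForce_cylinder {T : ℝ} (hT : 0 < T) (hM : M ≠ ⊤)
    (hcont : ContinuousOn (uncurry (physForce F)) (Ioo 0 T ×ˢ univ))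
    (hF : ∀ t ∈ Ioo 0 T, ∫⁻ ξ, ‖F (Real.log t) ξ‖ₑ ^ 2 ≤ M)
    {K : Set (EuclideanSpace ℝ (Fin 3))} (hK : IsCompact K) :
    IntegrableOn (uncurry (physForce F)) (Ioo 0 T ×ˢ K) volume := by
  have hmeas : AEStronglyMeasurable (uncurry (physForce F)) (volume.restrict (Ioo 0 T ×ˢ K)) :=
    (hcont.mono (prod_mono Subset.rfl (subset_univ K))).aestronglyMeasurable
      (measurableSet_Ioo.prod hK.measurableSet)
  refine ⟨hmeas, ?_⟩
  -- the slices are continuous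
  have hslice_cont : ∀ t ∈ Ioo 0 T, Continuous (physForce F t) := by
    intro t ht
    have h1 : ContinuousOn (fun x : EuclideanSpace ℝ (Fin 3) => uncurry (physForce F) (t, x)) univ :=
      hcont.comp (continuous_const.prodMk continuous_id).continuousOn
        fun x _ => mk_mem_prod ht (mem_univ x)
    exact continuousOn_univ.1 h1
  -- slice bound on `K`
  have hslice : ∀ t ∈ Ioo 0 T, ∫⁻ x in K, ‖physForce F t x‖ₑ ≤
      volume K ^ (1 / 2 : ℝ) * (ENNReal.ofReal (t ^ (-(3 / 4 : ℝ))) * M ^ (1 / 2 : ℝ)) := by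
    intro t ht
    calc ∫⁻ x in K, ‖physForce F t x‖ₑ
        ≤ volume K ^ (1 / 2 : ℝ) * eLpNorm (physForce F t) 2 volume :=
          setLIntegral_enorm_le_measure_rpow_mul_eLpNorm
            (hslice_cont t ht).aestronglyMeasurable K
      _ ≤ volume K ^ (1 / 2 : ℝ) * (ENNReal.ofReal (t ^ (-(3 / 4 : ℝ))) * M ^ (1 / 2 : ℝ)) := by
          gcongr
          exact eLpNorm_physForce_le ht.1 (hF t ht)
  -- integrate in time
  unfold HasFiniteIntegral
  rw [Measure.volume_eq_prod, ← Measure.prod_restrict]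
  calc ∫⁻ z, ‖uncurry (physForce F) z‖ₑ ∂((volume.restrict (Ioo 0 T)).prod (volume.restrict K))
      ≤ ∫⁻ t in Ioo 0 T, ∫⁻ x in K, ‖uncurry (physForce F) (t, x)‖ₑ := lintegral_prod_le _
    _ ≤ ∫⁻ t in Ioo 0 T, volume K ^ (1 / 2 : ℝ) *
          (ENNReal.ofReal (t ^ (-(3 / 4 : ℝ))) * M ^ (1 / 2 : ℝ)) :=
        setLIntegral_mono' measurableSet_Ioo fun t ht => hslice t ht
    _ = volume K ^ (1 / 2 : ℝ) * ((∫⁻ t in Ioo 0 T, ENNReal.ofReal (t ^ (-(3 / 4 : ℝ)))) *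
          M ^ (1 / 2 : ℝ)) := by
        rw [lintegral_const_mul' _ _ (ENNReal.rpow_ne_top_of_nonneg (by norm_num)
          hK.measure_lt_top.ne), lintegral_mul_const' _ _
            (ENNReal.rpow_ne_top_of_nonneg (by norm_num) hM)]
    _ < ⊤ := by
        refine ENNReal.mul_lt_top (ENNReal.rpow_lt_top_of_nonneg (by norm_num)
          hK.measure_lt_top.ne) (ENNReal.mul_lt_top ?_ (ENNReal.rpow_lt_top_of_nonneg
            (by norm_num) hM))
        exact lintegral_ofReal_rpow_Ioo_lt_top (by norm_num) hT

/-- **`f ∈ L¹(0, T; L²)` ((1.14))**: `‖f(t)‖₂ ≤ t^{-3/4}M^{1/2}` is integrable on `(0, T)`; this is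
the clause `MemLqLp 1 2 f (Ioo 0 T)` of `albritton_brue_colombo`. [cite: AlbrittonBrueColombo2022, (1.14)] -/
theorem memLqLp_physForce {T : ℝ} (hT : 0 < T) (hM : M ≠ ⊤)
    (hfm : ∀ t ∈ Ioo 0 T, AEStronglyMeasurable (physForce F t) volume)
    (hF : ∀ t ∈ Ioo 0 T, ∫⁻ ξ, ‖F (Real.log t) ξ‖ₑ ^ 2 ≤ M) :
    MemLqLp 1 2 (physForce F) (Ioo 0 T) := by
  have hbound : ∀ t ∈ Ioo 0 T, eLpNorm (physForce F t) 2 volume ≤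
      ENNReal.ofReal (t ^ (-(3 / 4 : ℝ))) * M ^ (1 / 2 : ℝ) := fun t ht =>
    eLpNorm_physForce_le ht.1 (hF t ht)
  have hfin : ∀ t ∈ Ioo 0 T, ENNReal.ofReal (t ^ (-(3 / 4 : ℝ))) * M ^ (1 / 2 : ℝ) < ⊤ := fun t _ =>
    ENNReal.mul_lt_top ENNReal.ofReal_lt_top (ENNReal.rpow_lt_top_of_nonneg (by norm_num) hM)
  refine ⟨(ae_restrict_iff' measurableSet_Ioo).2 (Eventually.of_forall fun t ht =>
    ⟨hfm t ht, (hbound t ht).trans_lt (hfin t ht)⟩), ?_⟩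
  rw [eLqLpNorm, eLpNorm_one_eq_lintegral_enorm]
  calc ∫⁻ t in Ioo 0 T, ‖(eLpNorm (physForce F t) 2 volume).toReal‖ₑ
      ≤ ∫⁻ t in Ioo 0 T, ENNReal.ofReal (t ^ (-(3 / 4 : ℝ))) * M ^ (1 / 2 : ℝ) := by
        refine setLIntegral_mono' measurableSet_Ioo fun t ht => ?_
        rw [Real.enorm_eq_ofReal ENNReal.toReal_nonneg]
        exact ENNReal.ofReal_toReal_le.trans (hbound t ht)
    _ = (∫⁻ t in Ioo 0 T, ENNReal.ofReal (t ^ (-(3 / 4 : ℝ)))) * M ^ (1 / 2 : ℝ) :=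
        lintegral_mul_const' _ _ (ENNReal.rpow_ne_top_of_nonneg (by norm_num) hM)
    _ < ⊤ := ENNReal.mul_lt_top (lintegral_ofReal_rpow_Ioo_lt_top (by norm_num) hT)
        (ENNReal.rpow_lt_top_of_nonneg (by norm_num) hM)

/-- **The datum `u₀ ≡ 0` is attained in `L²`**: `‖u(t)‖₂ ≤ (√t M)^{1/2} → 0` as `t → 0⁺`
(Albritton–Brué–Colombo 2022, (1.13) with `p = 2`, `k = 0`: `‖u(t)‖₂ ≲ t^{1/4}`). [cite: AlbrittonBrueColombo2022, (1.13)] -/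
theorem tendsto_eLpNorm_physVelocity_zero (hM : M ≠ ⊤) {T : ℝ} (hT : 0 < T)
    (hU : ∀ t ∈ Ioo 0 T, ∫⁻ ξ, ‖U (Real.log t) ξ‖ₑ ^ 2 ≤ M) :
    Tendsto (fun t => eLpNorm (physVelocity U t - 0) 2 volume) (𝓝[>] 0) (𝓝 0) := by
  have hb : Tendsto (fun t : ℝ => (ENNReal.ofReal (Real.sqrt t) * M) ^ (1 / 2 : ℝ)) (𝓝[>] 0) (𝓝 0) := by
    have h1 : Tendsto (fun t : ℝ => ENNReal.ofReal (Real.sqrt t)) (𝓝 0) (𝓝 0) := by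
      have hc : Continuous fun t : ℝ => ENNReal.ofReal (Real.sqrt t) :=
        ENNReal.continuous_ofReal.comp Real.continuous_sqrt
      simpa using hc.tendsto 0
    have h2 : Tendsto (fun t : ℝ => ENNReal.ofReal (Real.sqrt t) * M) (𝓝 0) (𝓝 0) := by
      simpa using ENNReal.Tendsto.mul_const h1 (Or.inr hM)
    have h3 := ((ENNReal.continuous_rpow_const (y := (1 / 2 : ℝ))).tendsto 0).comp h2
    rw [ENNReal.zero_rpow_of_pos (by norm_num)] at h3
    exact h3.mono_left nhdsWithin_le_nhds
  refine tendsto_of_tendsto_of_tendsto_of_le_of_le' tendsto_const_nhds hb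
    (Eventually.of_forall fun _ => zero_le) ?_
  filter_upwards [Ioo_mem_nhdsGT hT] with t ht
  rw [sub_zero]
  exact eLpNorm_physVelocity_le ht.1 (hU t ht)

end Bounds

/-! ### The force profile is smooth (general `E`) -/

section Force

variable {E : Type*} [NormedAddCommGroup E] [InnerProductSpace ℝ E] [FiniteDimensional ℝ E]
variable {S : Set ℝ} {F U : ℝ → E → E} {P : ℝ → E → ℝ}

/-- **The force profile of a solution of (1.9) is jointly smooth** on `S × E` (`S` of unique
differentiability): (1.9) determines `F` from `U`, `P` (as for `IsClassicalNSSolutionOn`,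
`isSmoothSpaceTimeOn_force`). [folklore] -/
theorem IsSimilarityNSSolutionOn.isSmoothSpaceTimeOn_force (h : IsSimilarityNSSolutionOn S F U P)
    (hS : UniqueDiffOn ℝ S) : IsSmoothSpaceTimeOn S F := by
  have hid : IsSmoothSpaceTimeOn S (fun (_ : ℝ) (ξ : E) => ξ) := contDiff_snd.contDiffOn
  have hsm : IsSmoothSpaceTimeOn S (fun τ ξ => timeDerivWithin S U τ ξ -
      (2⁻¹ : ℝ) • (U τ ξ + fderiv ℝ (U τ) ξ ξ) - (Δ (U τ)) ξ + convect (U τ) (U τ) ξ +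
        gradient (P τ) ξ) :=
    ((((h.smooth_velocity.timeDerivWithin hS).sub
      ((h.smooth_velocity.add ((h.smooth_velocity.fderiv_slice hS).clm_apply hid)).const_smul
        2⁻¹)).sub (h.smooth_velocity.laplacian hS)).add
          (h.smooth_velocity.convect h.smooth_velocity hS)).add (h.smooth_pressure.gradient hS)
  refine ContDiffOn.congr hsm fun z hz => ?_
  obtain ⟨τ, ξ⟩ := z
  exact (h.momentum τ hz.1 ξ).symm

/-- The slices `F τ`, `τ ∈ S`, of the force profile are continuous (`S` of unique
differentiability). [folklore] -/
theorem IsSimilarityNSSolutionOn.continuous_force_slice (h : IsSimilarityNSSolutionOn S F U P)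
    (hS : UniqueDiffOn ℝ S) {τ : ℝ} (hτ : τ ∈ S) : Continuous (F τ) :=
  ((h.isSmoothSpaceTimeOn_force hS).contDiff_slice hτ).continuous

end Force

/-! ### The Leray–Hopf property of the ansatz and the assembly of Thm. 1.2 from Thm. 1.3-type data -/

section Assembly

variable {τ₁ : ℝ} {F U : ℝ → EuclideanSpace ℝ (Fin 3) → EuclideanSpace ℝ (Fin 3)}
  {P : ℝ → EuclideanSpace ℝ (Fin 3) → ℝ} {M : ℝ≥0∞}

/-- **The ansatz of a bounded profile solution of (1.9) is a Leray–Hopf solution with datum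
`u₀ ≡ 0`** — the step "`ū`, `u` are Leray–Hopf solutions on `ℝ³ × (0, e^T)` with initial data
`u₀ ≡ 0` and forcing term `f̄`" of Albritton–Brué–Colombo 2022, Thm. 1.3, which the paper reads
off the decay rates (1.13)–(1.14) of solutions smooth for `t > 0`. Precisely: let `(U, P)` be a
classical solution of the similarity system (1.9) with force profile `F` on the similarity times
`τ < τ₁`, with `sup_τ` of `‖U(τ)‖₂²`, `‖∇U(τ)‖₂²`, `‖U(τ)‖₃³`, `‖P(τ)‖₂²`, `‖F(τ)‖₂²` finite
(`≤ M < ∞`). Then `u = physVelocity U` is a Leray–Hopf weak solution (accepted strict sense,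
energy equalities) of the Navier–Stokes system with viscosity `1`, force `f = physForce F` and
datum `0` on `[0, T']` for every `0 < T' < e^{τ₁}`. Proof: `(u, p, f)` is a classical solution on
`(0, e^{τ₁})` (`isClassicalNSSolutionOn_phys_Iio`); by the scalings of this file,
`‖u(t)‖₂ ≤ (√t M)^{1/2}` (so `u(t) → 0` in `L²`), `∫₀ᵀ‖∇u‖₂² ≤ M∫₀ᵀ t^{-1/2}dt`, `∫∫|u|³`, `∫∫|p||u|`
bounded on interior slabs, `∫∫|f||u| ≤ M∫t^{-1/2}`, `f ∈ L¹` on finite cylinders; conclude by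
`isLerayHopfOn_of_classical_Ioo_forced_R3`. [cite: AlbrittonBrueColombo2022, Thm. 1.3 with (1.13)–(1.14)] -/
theorem IsSimilarityNSSolutionOn.isLerayHopfOn_phys (h : IsSimilarityNSSolutionOn (Iio τ₁) F U P)
    (hM : M ≠ ⊤) (hU2 : ∀ τ < τ₁, ∫⁻ ξ, ‖U τ ξ‖ₑ ^ 2 ≤ M)
    (hDU : ∀ τ < τ₁, ∫⁻ ξ, ENNReal.ofReal (frobeniusNormSq (fderiv ℝ (U τ) ξ)) ≤ M)
    (hU3 : ∀ τ < τ₁, ∫⁻ ξ, ‖U τ ξ‖ₑ ^ (3 : ℕ) ≤ M)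
    (hP2 : ∀ τ < τ₁, ∫⁻ ξ, ‖P τ ξ‖ₑ ^ 2 ≤ M) (hF2 : ∀ τ < τ₁, ∫⁻ ξ, ‖F τ ξ‖ₑ ^ 2 ≤ M)
    {T' : ℝ} (hT' : 0 < T') (hT'T : T' < Real.exp τ₁) :
    IsLerayHopfOn T' 1 (physForce F) 0 (physVelocity U) := by
  set T : ℝ := Real.exp τ₁ with hT_def
  have hT : 0 < T := Real.exp_pos τ₁
  have hlog : ∀ {t : ℝ}, t ∈ Ioo 0 T → Real.log t < τ₁ := fun ht =>
    (Real.log_lt_iff_lt_exp ht.1).2 ht.2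
  have hcl : IsClassicalNSSolutionOn (Ioo 0 T) 1 (physForce F) (physVelocity U) (physPressure P) :=
    h.isClassicalNSSolutionOn_phys_Iio
  -- measurability of the profile slices
  have hUm : ∀ {t : ℝ}, t ∈ Ioo 0 T → AEStronglyMeasurable (U (Real.log t)) volume := fun ht =>
    (h.smooth_velocity.contDiff_slice (hlog ht)).continuous.aestronglyMeasurable
  have hPm : ∀ {t : ℝ}, t ∈ Ioo 0 T → AEStronglyMeasurable (P (Real.log t)) volume := fun ht =>
    (h.smooth_pressure.contDiff_slice (hlog ht)).continuous.aestronglyMeasurable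
  have hFm : ∀ {t : ℝ}, t ∈ Ioo 0 T → AEStronglyMeasurable (F (Real.log t)) volume := fun ht =>
    (h.continuous_force_slice isOpen_Iio.uniqueDiffOn (hlog ht)).aestronglyMeasurable
  -- the `L²` bound
  set L : ℝ≥0∞ := (ENNReal.ofReal (Real.sqrt T) * M) ^ (1 / 2 : ℝ) with hL_def
  have hLt : L ≠ ⊤ :=
    ENNReal.rpow_ne_top_of_nonneg (by norm_num) (ENNReal.mul_ne_top ENNReal.ofReal_ne_top hM)
  have hL : ∀ t ∈ Ioo 0 T, eLpNorm (physVelocity U t) 2 volume ≤ L := by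
    intro t ht
    refine (eLpNorm_physVelocity_le ht.1 (hU2 _ (hlog ht))).trans ?_
    rw [hL_def]
    gcongr
    exact ht.2.le
  -- the dissipation
  have hgrad : ∫⁻ t in Ioo 0 T, ∫⁻ x,
      ENNReal.ofReal (frobeniusNormSq (fderiv ℝ (physVelocity U t) x)) < ⊤ := by
    calc ∫⁻ t in Ioo 0 T, ∫⁻ x, ENNReal.ofReal (frobeniusNormSq (fderiv ℝ (physVelocity U t) x))
        = ∫⁻ t in Ioo 0 T, ENNReal.ofReal ((Real.sqrt t)⁻¹) *
            ∫⁻ ξ, ENNReal.ofReal (frobeniusNormSq (fderiv ℝ (U (Real.log t)) ξ)) :=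
          setLIntegral_congr_fun measurableSet_Ioo fun t ht =>
            lintegral_frobeniusNormSq_fderiv_physVelocity ht.1 U
      _ ≤ ∫⁻ t in Ioo 0 T, ENNReal.ofReal ((Real.sqrt t)⁻¹) * M :=
          setLIntegral_mono' measurableSet_Ioo fun t ht => by
            gcongr
            exact hDU _ (hlog ht)
      _ = (∫⁻ t in Ioo 0 T, ENNReal.ofReal ((Real.sqrt t)⁻¹)) * M := lintegral_mul_const' _ _ hM
      _ < ⊤ := ENNReal.mul_lt_top (lintegral_ofReal_sqrt_inv_Ioo_lt_top hT) hM.lt_top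
  -- `u ∈ L³` on interior slabs
  have hu₃ : ∀ s t : ℝ, 0 < s → s < t → t < T →
      ∫⁻ τ in Ioo s t, ∫⁻ x, ‖physVelocity U τ x‖ₑ ^ (3 : ℕ) < ⊤ := by
    intro s t hs hst htT
    calc ∫⁻ τ in Ioo s t, ∫⁻ x, ‖physVelocity U τ x‖ₑ ^ (3 : ℕ)
        ≤ ∫⁻ _ in Ioo s t, M := setLIntegral_mono' measurableSet_Ioo fun τ hτ => by
          rw [lintegral_enorm_cube_physVelocity (hs.trans hτ.1) U]
          exact hU3 _ (hlog ⟨hs.trans hτ.1, hτ.2.trans htT⟩)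
      _ < ⊤ := by
          rw [setLIntegral_const]
          exact ENNReal.mul_lt_top hM.lt_top measure_Ioo_lt_top
  -- `p u ∈ L¹` on interior slabs
  have hpu : ∀ s t : ℝ, 0 < s → s < t → t < T →
      ∫⁻ τ in Ioo s t, ∫⁻ x, ‖physPressure P τ x‖ₑ * ‖physVelocity U τ x‖ₑ < ⊤ := by
    intro s t hs hst htT
    calc ∫⁻ τ in Ioo s t, ∫⁻ x, ‖physPressure P τ x‖ₑ * ‖physVelocity U τ x‖ₑ
        ≤ ∫⁻ _ in Ioo s t, M := setLIntegral_mono' measurableSet_Ioo fun τ hτ => by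
          have hτT : τ ∈ Ioo 0 T := ⟨hs.trans hτ.1, hτ.2.trans htT⟩
          exact lintegral_enorm_physPressure_mul_physVelocity_le hτT.1 (hPm hτT) (hUm hτT)
            (hP2 _ (hlog hτT)) (hU2 _ (hlog hτT))
      _ < ⊤ := by
          rw [setLIntegral_const]
          exact ENNReal.mul_lt_top hM.lt_top measure_Ioo_lt_top
  -- the work of the force
  have hfu : ∫⁻ t in Ioo 0 T, ∫⁻ x, ‖physForce F t x‖ₑ * ‖physVelocity U t x‖ₑ < ⊤ := by
    calc ∫⁻ t in Ioo 0 T, ∫⁻ x, ‖physForce F t x‖ₑ * ‖physVelocity U t x‖ₑ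
        ≤ ∫⁻ t in Ioo 0 T, ENNReal.ofReal ((Real.sqrt t)⁻¹) * M :=
          setLIntegral_mono' measurableSet_Ioo fun t ht =>
            lintegral_enorm_physForce_mul_physVelocity_le ht.1 (hFm ht) (hUm ht)
              (hF2 _ (hlog ht)) (hU2 _ (hlog ht))
      _ = (∫⁻ t in Ioo 0 T, ENNReal.ofReal ((Real.sqrt t)⁻¹)) * M := lintegral_mul_const' _ _ hM
      _ < ⊤ := ENNReal.mul_lt_top (lintegral_ofReal_sqrt_inv_Ioo_lt_top hT) hM.lt_top
  -- `f ∈ L¹` on the finite cylinders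
  have hfK : ∀ K : Set (EuclideanSpace ℝ (Fin 3)), IsCompact K →
      IntegrableOn (uncurry (physForce F)) (Ioo 0 T ×ˢ K) volume := fun K hK =>
    integrableOn_physForce_cylinder hT hM (hcl.continuousOn_force isOpen_Ioo.uniqueDiffOn)
      (fun t ht => hF2 _ (hlog ht)) hK
  -- the datum
  have h0 : Tendsto (fun t => eLpNorm (physVelocity U t - 0) 2 volume) (𝓝[>] 0) (𝓝 0) :=
    tendsto_eLpNorm_physVelocity_zero hM hT fun t ht => hU2 _ (hlog ht)
  exact isLerayHopfOn_of_classical_Ioo_forced_R3 hT' hT'T hcl (fun t _ => rfl)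
    (physVelocity_zero U) MemLp.zero h0 hLt hL hgrad hu₃ hpu hfu hfK

/-- **Distinct profiles give distinct solutions**: if `U₁(τ₀) ≠ U₂(τ₀)` on a set of positive
measure, then `u₁(t₀) ≠ u₂(t₀)` on a set of positive measure at `t₀ = e^{τ₀}` (the dilation
`x ↦ x/√t₀` is a measurable automorphism multiplying Lebesgue measure by a positive constant).
[folklore] -/
theorem not_ae_eq_physVelocity_exp {U₁ U₂ : ℝ → EuclideanSpace ℝ (Fin 3) → EuclideanSpace ℝ (Fin 3)}
    {τ₀ : ℝ} (hne : ¬ (U₁ τ₀ =ᵐ[volume] U₂ τ₀)) :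
    ¬ (physVelocity U₁ (Real.exp τ₀) =ᵐ[volume] physVelocity U₂ (Real.exp τ₀)) := by
  intro hae
  apply hne
  set c : ℝ := (Real.sqrt (Real.exp τ₀))⁻¹ with hc_def
  have hc : c ≠ 0 := (sqrt_inv_pos (Real.exp_pos τ₀)).ne'
  have h1 : ∀ᵐ x ∂(volume : Measure (EuclideanSpace ℝ (Fin 3))), U₁ τ₀ (c • x) = U₂ τ₀ (c • x) := by
    filter_upwards [hae] with x hx
    simp only [physVelocity_apply, Real.log_exp, ← hc_def] at hx
    exact smul_right_injective _ hc hx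
  have hemb : MeasurableEmbedding (fun x : EuclideanSpace ℝ (Fin 3) => c • x) :=
    measurableEmbedding_const_smul₀ hc
  have h2 : ∀ᵐ y ∂(Measure.map (fun x : EuclideanSpace ℝ (Fin 3) => c • x) volume),
      U₁ τ₀ y = U₂ τ₀ y := hemb.ae_map_iff.2 h1
  rw [Measure.map_addHaar_smul volume hc] at h2
  have hk : ENNReal.ofReal |(c ^ Module.finrank ℝ (EuclideanSpace ℝ (Fin 3)))⁻¹| ≠ 0 :=
    (ENNReal.ofReal_pos.2 (abs_pos.2 (inv_ne_zero (pow_ne_zero _ hc)))).ne'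
  rw [ae_iff, Measure.smul_apply, smul_eq_mul, mul_eq_zero] at h2
  exact ae_iff.2 (h2.resolve_left hk)

end Assembly

end AlbrittonBrueColombo2022

/-! ### The assembly: Theorem 1.3-type profile data ⟹ `albritton_brue_colombo_unit` ⟹ `albritton_brue_colombo` -/

section Final

open AlbrittonBrueColombo2022

/-- **Theorem 1.2 of Albritton–Brué–Colombo, faithfully rendered, from Theorem 1.3-type data**
(the assembly "The above arguments culminate in … Theorem 1.3", whose part (b) asserts that `ū`
and `u = ū + u^{lin} + u^{per}` are two distinct Leray–Hopf solutions on `ℝ³ × (0, e^T)` with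
`u₀ ≡ 0` and force `f̄`, followed by Thm. 1.3 ⟹ Thm. 1.2): if the similarity system (1.9) with
ONE force profile `F` has TWO classical solutions `(U₁, P₁)`, `(U₂, P₂)` on the similarity times
`τ < τ₁`, with the uniform bounds of `isLerayHopfOn_phys` and differing at some similarity time
`τ₀ < τ₁` on a set of positive measure, then the printed unit-viscosity statement — the named
fact `albritton_brue_colombo_unit`, in its rendering faithful to Def. 1.1
(`f ∈ L¹_t L²_x(ℝ³ × (0,T))`, a Bochner class) — holds: with `t₀ = e^{τ₀}` and
`T = (t₀ + e^{τ₁})/2`, the force `f = physForce F` is **jointly measurable on `(0, T) × ℝ³`**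
(it is continuous there, being the force of the classical solution `physVelocity U₁`:
`IsClassicalNSSolutionOn.continuousOn_force`) and lies in `L¹(0,T;L²)` (`memLqLp_physForce`,
(1.14)), and the fields `physVelocity Uᵢ` are Leray–Hopf solutions on `[0, T]` with force `f`
and datum `0`, distinct at `t₀ ∈ (0, T)` (`not_ae_eq_physVelocity_exp`). (The measurability
clause is exactly what the degenerate non-measurable force of
`ABCVacuity.unit_rendering_is_vacuous`, `NSLerayHopfABCVacuity.lean` — a proof of the fact's
retired first rendering — lacks.)
The hypothesis is what [ABC] Thm. 1.3 (b) delivers for `U₁ = Ū` (steady, (1.11)) and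
`U₂ = Ū + U^{lin} + U^{per}` (`‖U^{per}‖_{H^k} ≲ e^{2τa}`, `U^{lin} = Re(e^{λτ}η)`, `Ū ∈ C_c^∞`);
it is NOT proved here (it is the analytic core of the paper: Vishik's unstable vortex §2, the
Euler-to-Navier–Stokes spectral perturbation §3, the nonlinear instability Thm. 4.1).
[cite: AlbrittonBrueColombo2022, Thm. 1.3 ⟹ Thm. 1.2 with Def. 1.1] -/
theorem albritton_brue_colombo_unit_of_similarityProfiles {τ₁ : ℝ}
    {F U₁ U₂ : ℝ → EuclideanSpace ℝ (Fin 3) → EuclideanSpace ℝ (Fin 3)}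
    {P₁ P₂ : ℝ → EuclideanSpace ℝ (Fin 3) → ℝ} {M : ℝ≥0∞} (hM : M ≠ ⊤)
    (h₁ : IsSimilarityNSSolutionOn (Iio τ₁) F U₁ P₁) (h₂ : IsSimilarityNSSolutionOn (Iio τ₁) F U₂ P₂)
    (hU2 : ∀ τ < τ₁, ∫⁻ ξ, ‖U₁ τ ξ‖ₑ ^ 2 ≤ M ∧ ∫⁻ ξ, ‖U₂ τ ξ‖ₑ ^ 2 ≤ M)
    (hDU : ∀ τ < τ₁, ∫⁻ ξ, ENNReal.ofReal (frobeniusNormSq (fderiv ℝ (U₁ τ) ξ)) ≤ M ∧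
      ∫⁻ ξ, ENNReal.ofReal (frobeniusNormSq (fderiv ℝ (U₂ τ) ξ)) ≤ M)
    (hU3 : ∀ τ < τ₁, ∫⁻ ξ, ‖U₁ τ ξ‖ₑ ^ (3 : ℕ) ≤ M ∧ ∫⁻ ξ, ‖U₂ τ ξ‖ₑ ^ (3 : ℕ) ≤ M)
    (hP2 : ∀ τ < τ₁, ∫⁻ ξ, ‖P₁ τ ξ‖ₑ ^ 2 ≤ M ∧ ∫⁻ ξ, ‖P₂ τ ξ‖ₑ ^ 2 ≤ M)
    (hF2 : ∀ τ < τ₁, ∫⁻ ξ, ‖F τ ξ‖ₑ ^ 2 ≤ M)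
    (hne : ∃ τ₀ < τ₁, ¬ (U₁ τ₀ =ᵐ[volume] U₂ τ₀)) :
    albritton_brue_colombo_unit := by
  obtain ⟨τ₀, hτ₀, hne⟩ := hne
  set t₀ : ℝ := Real.exp τ₀ with ht₀_def
  set T : ℝ := (t₀ + Real.exp τ₁) / 2 with hT_def
  have ht₀T₁ : t₀ < Real.exp τ₁ := Real.exp_lt_exp.2 hτ₀
  have ht₀ : 0 < t₀ := Real.exp_pos τ₀
  have hT : 0 < T := by rw [hT_def]; positivity
  have ht₀T : t₀ < T := by rw [hT_def]; linarith
  have hTT₁ : T < Real.exp τ₁ := by rw [hT_def]; linarith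
  have hlog : ∀ {t : ℝ}, t ∈ Ioo 0 T → Real.log t < τ₁ := fun ht =>
    (Real.log_lt_iff_lt_exp ht.1).2 (ht.2.trans hTT₁)
  -- the force is the force of a classical solution on `(0, e^{τ₁}) × ℝ³`, hence continuous there
  have hcl : IsClassicalNSSolutionOn (Ioo 0 (Real.exp τ₁)) 1 (physForce F) (physVelocity U₁)
      (physPressure P₁) := h₁.isClassicalNSSolutionOn_phys_Iio
  have hmeas : AEStronglyMeasurable (uncurry (physForce F)) (volume.restrict (Ioo 0 T ×ˢ univ)) :=
    ((hcl.continuousOn_force isOpen_Ioo.uniqueDiffOn).mono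
      (prod_mono (Ioo_subset_Ioo_right hTT₁.le) Subset.rfl)).aestronglyMeasurable
      (measurableSet_Ioo.prod MeasurableSet.univ)
  refine ⟨T, hT, physForce F, hmeas, ?_, physVelocity U₁, physVelocity U₂,
    h₁.isLerayHopfOn_phys hM (fun τ hτ => (hU2 τ hτ).1) (fun τ hτ => (hDU τ hτ).1)
      (fun τ hτ => (hU3 τ hτ).1) (fun τ hτ => (hP2 τ hτ).1) hF2 hT hTT₁,
    h₂.isLerayHopfOn_phys hM (fun τ hτ => (hU2 τ hτ).2) (fun τ hτ => (hDU τ hτ).2)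
      (fun τ hτ => (hU3 τ hτ).2) (fun τ hτ => (hP2 τ hτ).2) hF2 hT hTT₁,
    t₀, ⟨ht₀, ht₀T⟩, not_ae_eq_physVelocity_exp hne⟩
  -- `f ∈ L¹(0, T; L²)`
  refine memLqLp_physForce hT hM (fun t ht => ?_) (fun t ht => hF2 _ (hlog ht))
  exact (hcl.continuous_force_slice isOpen_Ioo.uniqueDiffOn ⟨ht.1, ht.2.trans hTT₁⟩).aestronglyMeasurable

/-- **ns.S20 (`albritton_brue_colombo`, every viscosity) from Theorem 1.3-type data**, by
`albritton_brue_colombo_unit_of_similarityProfiles` and the viscosity scaling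
`albritton_brue_colombo_of_unit` (`NSLerayHopfABCScaling.lean`; it forgets the measurability of
the force). This closes the formal rendering of everything in [ABC] downstream of Thm. 1.3
(a)–(b): what remains between this theorem and `albritton_brue_colombo_unit_holds` is exactly an
inhabitant of its hypotheses, i.e. the analytic core of the paper.
[cite: AlbrittonBrueColombo2022, Thm. 1.3 ⟹ Thm. 1.2] -/
theorem albritton_brue_colombo_of_similarityProfiles {τ₁ : ℝ}
    {F U₁ U₂ : ℝ → EuclideanSpace ℝ (Fin 3) → EuclideanSpace ℝ (Fin 3)}
    {P₁ P₂ : ℝ → EuclideanSpace ℝ (Fin 3) → ℝ} {M : ℝ≥0∞} (hM : M ≠ ⊤)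
    (h₁ : IsSimilarityNSSolutionOn (Iio τ₁) F U₁ P₁) (h₂ : IsSimilarityNSSolutionOn (Iio τ₁) F U₂ P₂)
    (hU2 : ∀ τ < τ₁, ∫⁻ ξ, ‖U₁ τ ξ‖ₑ ^ 2 ≤ M ∧ ∫⁻ ξ, ‖U₂ τ ξ‖ₑ ^ 2 ≤ M)
    (hDU : ∀ τ < τ₁, ∫⁻ ξ, ENNReal.ofReal (frobeniusNormSq (fderiv ℝ (U₁ τ) ξ)) ≤ M ∧
      ∫⁻ ξ, ENNReal.ofReal (frobeniusNormSq (fderiv ℝ (U₂ τ) ξ)) ≤ M)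
    (hU3 : ∀ τ < τ₁, ∫⁻ ξ, ‖U₁ τ ξ‖ₑ ^ (3 : ℕ) ≤ M ∧ ∫⁻ ξ, ‖U₂ τ ξ‖ₑ ^ (3 : ℕ) ≤ M)
    (hP2 : ∀ τ < τ₁, ∫⁻ ξ, ‖P₁ τ ξ‖ₑ ^ 2 ≤ M ∧ ∫⁻ ξ, ‖P₂ τ ξ‖ₑ ^ 2 ≤ M)
    (hF2 : ∀ τ < τ₁, ∫⁻ ξ, ‖F τ ξ‖ₑ ^ 2 ≤ M)
    (hne : ∃ τ₀ < τ₁, ¬ (U₁ τ₀ =ᵐ[volume] U₂ τ₀)) :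
    albritton_brue_colombo :=
  albritton_brue_colombo_of_unit
    (albritton_brue_colombo_unit_of_similarityProfiles hM h₁ h₂ hU2 hDU hU3 hP2 hF2 hne)

end Final

end Literature.Analysis.FluidPDE

end
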